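import Summits.QuantumFields.YangMills.Theorems.BalabanUVNodesK0Stub1FlatChartKernel157P
import Summits.QuantumFields.YangMills.Theorems.BalabanUVNodesK0Stub1DtColumnSocket
import Summits.QuantumFields.YangMills.Theorems.BalabanUVNodesK0Stub1SectFWSlotAtRecordFlatChart
import HarnessLib

/-!
# K0⁷ STUB 1 (`stub_prop8StepCoP13`), sub-target S4b «the (δ∕δA′)V pieces at objects» — **`θ₀♭` DISCHARGED: THE (73)ᵀ COLUMN LETTER OF THE ♭ CHART's REMAINDER
# DERIVATIVE AT THE RECORD, k-UNIFORMLY** (`θ₀♭ = 16·Θ♭(L)·M_ρ`; the column sum `hcol♭` of the ♭ kernel + this seat's `θ₀` socket p624155 + FILE A's `hentry♭`)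

Cell `pub-ymgap`, width seat `pub-ymgap-k0-s1-w2` g5 (CLAIM-2).  `--kind proof --supports stmt-QuantumFields-20541 --as helper`; count-neutral; def-free.
[15] = [Balaban1985Variational]; [B7] = [Balaban1985Averaging]; [B6] = [Balaban1984PropagatorsII].

WHY.  k0-s1-w4's ♭ junction `K0Stub1SectFWSlotAtRecordFlatChart.exists_sectF_W_atRecord_flatChart` (p623337; over this seat's chart Socket p621022) gives [15] Sect. F's
`W = (δ∕δA′)V` at every admissible family of the record's four-tori with EVERY letter discharged EXCEPT: the remainder socket of the ♭ chart (closed by their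
`K0Stub1FlatChartRemainderP.flatChartRemainderSocket_T4`, p624568), the (73)ᵀ column letter `h73t(θ₀)` of the transposed derivative `Dt` of `Dfun♭`, and the arithmetic
letter `ℓ`.  This seat's `θ₀` socket `K0Stub1DtColumnSocket.h73t_of_kernelEntries` (p624155) reduces `h73t` to kernel entries `hentry` + a weighted column sum `hcol`;
FILE A of this generation (`K0Stub1FlatChartKernel157P.hentry_flat_P`) IS `hentry` for `Dfun♭` with the ♭ kernel `κ♭(t,b) = 𝟙[t reads b]·η·(L·L^{−d})^{J(t)}`.
THIS FILE supplies `hcol` (lattice geometry, by the route `UnitScaleTilt`'s P-generic column count `ChartRemainderColumnLetter.sum_srcReaders_geom_le`: every index bond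
reading `b` has level `≥ lev(b₋)`, at most `2d` per level, geometric tail), DISCHARGES `h73t` with `θ₀♭ := 16·M_ρ·Θ♭(L)` at `d = 4` (k-UNIFORM — the point of the
(R1′) ♭ re-base: LOCATED-BASEPOINT, evidence #51); the sequel closes the junction (the ♭ W-slot with constants quantified BEFORE the family).

WHAT IS PROVED (sorry-free; no definition; axioms standard).  `η := (L⁻¹)^k`, `x := L·(Lᵈ)⁻¹`, `Θ♭ := 16·A′·L∕(1 − 2∕L − 1∕12)`, `A′ := (2560ℓ∕(400ℓ)⁻¹)·2d∕(L²(Lᵈ)⁻¹)`.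
* §1 ★ `flatKernel_columnSum_le` — generic `P`, any nested `D`: `Σ_{t : 𝔅} κ♭(t,b) ≤ 4d·η·x^{lev(b₋)}` (`sum_srcReaders_geom_le` at `x ≤ 1∕3`).
* §1 ★★ `hcol_flat` — generic `P` with `4 ≤ d`, `IsLevWeight P k D w` (`D.k = k`): `w 3 b·Σ_t κ♭(t,b) ≤ 4d·η⁴` (`(L³x)^{lev} = (L⁴L^{−d})^{lev} ≤ 1`).
* §2 ★★★ `h73t_flat_P` — generic `P` (`4 ≤ d`), fibre `M_n(ℂ)`, `Adm22 D R′ M`, `2L ≤ R′M + 1`, the fibre letters (`τ` tracial contractive, dualiser `ρ`, `‖ρℓ‖ ≤ M_ρ‖ℓ‖`),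
  the pairings `BE = bondPair η d τ`, `B = Σ_t τ`, ANY `Dt` with `BE (Dt A′ X) δ = B X (fderiv ℂ Dfun♭ A′ δ)`, any `ε` in FILE A's four windows: the `h73t` binder of
  p612123 ∕ p621022 ∕ p623337 at unit block weight HOLDS with `θ₀ := (|η|ᵈ)⁻¹·M_ρ·Θ♭·(4d·η⁴)` (p624155 ∘ FILE A ∘ §1).
* §2 ★★★ `h73t_flat_T4` — the record edition (`F : T4Family`, `P := F.P K`, `k := K − n`, `Matrix (Fin N) (Fin N) ℂ`): `θ₀♭ = (16·Θ♭)·M_ρ`, k-UNIFORM.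
* (sequel `…K0Stub1SectFWSlotAtRecordFlatChartAllLetters`: the junction over p623337 ∕ p624568 with `θ₀` (§2) and `ℓ` discharged — no displayed analytic letter left.)
HONEST SCOPE.  Lattice-geometric bookkeeping + `exact` assembly of cited files (this seat p624155∕FILE A, route `UnitScaleTilt`'s P-generic count, k0-s1-w4's
`nonempty_bondIdx`); nothing of [15] Sects. D–F or [B7] asserted beyond the engines cited BY NAME; the measure-level identification of the record's constraint with the ♭
functional ((92)∕(97)∕(99), LOCATED (R1′) all-or-nothing) is the planners'∕S2's and is NOT asserted; `stub_prop8StepCoP13` ∕ K0⁷ NOT closed; N07 NOT discharged; no summit statement is proved by this seat; counts unmoved (28∕28 · 5∕27); one finite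
𝕋⁴ programme at fixed ε — R4 closes the conditional finite-𝕋⁴ rung `BalabanLadder.UV` only, never the summit; the YM mass gap (Clay) is NOT proved by any of this; nothing
continuum ∕ ℝ⁴ ∕ OS.  No `sorry`, no `def`, no `instance`, no `notation`.

References: [15] (27) p.282, (44)–(48) p.285, (55) p.286, (72)–(73) p.289, Prop. 4 (97)–(98) pp.292–293, (152) p.301, (157)–(158) p.302; [B7] Prop. 5 (157) p.42,
(140)–(141) p.39; [B6] (2.2)–(2.4) p.224, Cor. 2.8 p.249; [Balaban1987RG1] (0.1) p.251.
-/

set_option autoImplicit false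

noncomputable section

open scoped BigOperators Matrix.Norms.L2Operator Topology ContDiff

namespace Summit.QuantumFields.YangMills.Theorems.K0Stub1FlatChartTheta0AtRecord

open Literature.MathematicalPhysics.QuantumFieldTheory.Balaban1983to89
open Literature.MathematicalPhysics.QuantumFieldTheory.Balaban1983to89.T4Continuum (T4Family)
open B5Eq118OneStroke (iterBlockOf)
open B6SectADomainsV1 (Domains)
open B6SectAOperatorsV1 (BondIdx)
open B9Eq39Adjoint (bondPair)
open B11Eq115Space (levOf)
open Summit.QuantumFields.YangMills.Theorems.FlatCubeOpsText (Adm22)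
open Summit.QuantumFields.YangMills.Theorems.K0FlatCubeOpsTextP (IsLevWeight)
open Summit.QuantumFields.YangMills.Theorems.Prop8ChartDoubleBar (chartLogFlat)
open Summit.QuantumFields.YangMills.Theorems.ChartRemainderColumnLetter (sum_srcReaders_geom_le)
open Summit.QuantumFields.YangMills.Theorems.K0Stub1FlatChartKernel157P (hentry_flat_P)
open Summit.QuantumFields.YangMills.Theorems.K0Stub1DtColumnSocket (h73t_of_kernelEntries)
open Summit.QuantumFields.YangMills.Theorems.K0Stub1SectFWSlotAtRecordFlatChart (nonempty_bondIdx)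

variable {P : Params}

/-! ## §1  The weighted column sum of the ♭ kernel `κ♭(t,b) = 𝟙[t reads b]·η·(L·L^{−d})^{J(t)}` -/

section Column

/-- ★ **THE COLUMN SUM OF THE ♭ KERNEL**: for every nested family `D` and fine bond `b`, `Σ_{t : 𝔅} κ♭(t,b) ≤ 4d·η·x^{lev(b₋)}`, `x = L·(Lᵈ)⁻¹`, `η = (L⁻¹)^k`, where
`κ♭(t,b) := if t reads b then η·(L^{J(t)}·((Lᵈ)⁻¹)^{J(t)}) else 0` — every index bond reading `b` has level `≥ lev(b₋)` (nestedness), at most `2d` per level, geometric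
tail with ratio `x ≤ 1∕3` (the route `UnitScaleTilt`'s `ChartRemainderColumnLetter.sum_srcReaders_geom_le`, `2 ≤ d`).
[cite: Balaban1984PropagatorsII, (2.3)-(2.4) p.224; Balaban1985Averaging, (140)-(141) p.39] -/
theorem flatKernel_columnSum_le (hd : 2 ≤ P.d) (k : ℕ) (D : Domains P) (b : PBond P 0) :
    ∑ t : BondIdx D,
        (if (iterBlockOf (t.1.1 : ℕ) b.src = t.1.2.src ∨ iterBlockOf (t.1.1 : ℕ) b.src = t.1.2.tgt) ∧
              (iterBlockOf (t.1.1 : ℕ) b.tgt = t.1.2.src ∨ iterBlockOf (t.1.1 : ℕ) b.tgt = t.1.2.tgt)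
          then ((P.L : ℝ)⁻¹) ^ k * ((P.L : ℝ) ^ (t.1.1 : ℕ) * (((P.L : ℝ) ^ P.d)⁻¹) ^ (t.1.1 : ℕ)) else 0) ≤
      4 * (P.d : ℝ) * ((P.L : ℝ)⁻¹) ^ k * ((P.L : ℝ) * ((P.L : ℝ) ^ P.d)⁻¹) ^ levOf (fun j => {y : Site P 0 | D.InOm j y}) D.k b.src := by
  set η : ℝ := ((P.L : ℝ)⁻¹) ^ k with hη
  set x : ℝ := (P.L : ℝ) * ((P.L : ℝ) ^ P.d)⁻¹ with hx
  set lev : ℕ := levOf (fun j => {y : Site P 0 | D.InOm j y}) D.k b.src with hlev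
  have hL3 : 3 ≤ P.L := by obtain ⟨⟨k', hk'⟩, h1⟩ := P.hL; omega
  have hL3r : (3 : ℝ) ≤ P.L := by exact_mod_cast hL3
  have hL0 : (0 : ℝ) < P.L := by linarith
  have hη0 : 0 ≤ η := by rw [hη]; positivity
  have hx0 : 0 ≤ x := by rw [hx]; positivity
  -- `x = L^{1−d} ≤ 1∕L ≤ 1∕3`
  have hx3 : x ≤ 1 / 3 := by
    rw [hx]
    have hLd : (P.L : ℝ) * (P.L : ℝ) ≤ (P.L : ℝ) ^ P.d := by
      calc (P.L : ℝ) * (P.L : ℝ) = (P.L : ℝ) ^ 2 := by ring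
        _ ≤ (P.L : ℝ) ^ P.d := pow_le_pow_right₀ (by linarith) hd
    have hpos : 0 < (P.L : ℝ) ^ P.d := by positivity
    rw [← div_eq_mul_inv, div_le_iff₀ hpos]
    have : (P.L : ℝ) * 3 ≤ (P.L : ℝ) * (P.L : ℝ) := mul_le_mul_of_nonneg_left hL3r hL0.le
    linarith
  have hx1 : x < 1 := by linarith
  have hpow : ∀ J : ℕ, (P.L : ℝ) ^ J * (((P.L : ℝ) ^ P.d)⁻¹) ^ J = x ^ J := fun J => by rw [hx, mul_pow]
  -- termwise: `κ♭(t,b) ≤ η·𝟙[B^J(b₋) ∈ {c₋, c₊}]·x^J`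
  have hterm : ∀ t : BondIdx D,
      (if (iterBlockOf (t.1.1 : ℕ) b.src = t.1.2.src ∨ iterBlockOf (t.1.1 : ℕ) b.src = t.1.2.tgt) ∧
            (iterBlockOf (t.1.1 : ℕ) b.tgt = t.1.2.src ∨ iterBlockOf (t.1.1 : ℕ) b.tgt = t.1.2.tgt)
        then η * ((P.L : ℝ) ^ (t.1.1 : ℕ) * (((P.L : ℝ) ^ P.d)⁻¹) ^ (t.1.1 : ℕ)) else 0) ≤
      η * (if (iterBlockOf (t.1.1 : ℕ) b.src = t.1.2.src ∨ iterBlockOf (t.1.1 : ℕ) b.src = t.1.2.tgt) then x ^ (t.1.1 : ℕ) else 0) := by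
    intro t
    by_cases hr : (iterBlockOf (t.1.1 : ℕ) b.src = t.1.2.src ∨ iterBlockOf (t.1.1 : ℕ) b.src = t.1.2.tgt) ∧
        (iterBlockOf (t.1.1 : ℕ) b.tgt = t.1.2.src ∨ iterBlockOf (t.1.1 : ℕ) b.tgt = t.1.2.tgt)
    · rw [if_pos hr, if_pos hr.1, hpow]
    · rw [if_neg hr]
      by_cases hs : iterBlockOf (t.1.1 : ℕ) b.src = t.1.2.src ∨ iterBlockOf (t.1.1 : ℕ) b.src = t.1.2.tgt
      · rw [if_pos hs]; positivity
      · rw [if_neg hs, mul_zero]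
  have hgeom := sum_srcReaders_geom_le D b hx0 hx1
  have hfrac : x ^ lev / (1 - x) ≤ 2 * x ^ lev := by
    rw [div_le_iff₀ (by linarith)]
    have hxl : 0 ≤ x ^ lev := pow_nonneg hx0 _
    nlinarith
  calc _ ≤ ∑ t : BondIdx D, η * (if (iterBlockOf (t.1.1 : ℕ) b.src = t.1.2.src ∨ iterBlockOf (t.1.1 : ℕ) b.src = t.1.2.tgt) then x ^ (t.1.1 : ℕ) else 0) :=
        Finset.sum_le_sum fun t _ => hterm t
    _ = η * ∑ t : BondIdx D, (if (iterBlockOf (t.1.1 : ℕ) b.src = t.1.2.src ∨ iterBlockOf (t.1.1 : ℕ) b.src = t.1.2.tgt) then x ^ (t.1.1 : ℕ) else 0) := by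
        rw [Finset.mul_sum]
    _ ≤ η * (2 * P.d * (x ^ lev / (1 - x))) := mul_le_mul_of_nonneg_left hgeom hη0
    _ ≤ η * (2 * P.d * (2 * x ^ lev)) := mul_le_mul_of_nonneg_left (mul_le_mul_of_nonneg_left hfrac (by positivity)) hη0
    _ = 4 * (P.d : ℝ) * η * x ^ lev := by ring

/-- ★★ **`hcol♭`: THE WEIGHTED COLUMN SUM OF THE ♭ KERNEL AT UNIT BLOCK WEIGHT**, `4 ≤ d`: for the (152) level weights `K0FlatCubeOpsTextP.IsLevWeight P k D w` (`D.k = k`),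
`w 3 b·Σ_{t : 𝔅} κ♭(t,b)·1⁻¹ ≤ 4d·η⁴` at every fine bond — `w 3 b = (L^{lev}η)³` and `(L³·L·L^{−d})^{lev} ≤ 1`; k-UNIFORM after the `(|η|ᵈ)⁻¹` of the (27) pairing exactly
when `d = 4`. [cite: Balaban1985Variational, (27) p.282, (73) p.289, (152) p.301; Balaban1984PropagatorsII, (2.3)-(2.4) p.224] -/
theorem hcol_flat (hd : 4 ≤ P.d) (k : ℕ) (D : Domains P) (hDk : D.k = k) {w : ℕ → PBond P 0 → ℝ} (hw : IsLevWeight P k D w) (b : PBond P 0) :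
    w 3 b * ∑ t : BondIdx D,
        (if (iterBlockOf (t.1.1 : ℕ) b.src = t.1.2.src ∨ iterBlockOf (t.1.1 : ℕ) b.src = t.1.2.tgt) ∧
              (iterBlockOf (t.1.1 : ℕ) b.tgt = t.1.2.src ∨ iterBlockOf (t.1.1 : ℕ) b.tgt = t.1.2.tgt)
          then ((P.L : ℝ)⁻¹) ^ k * ((P.L : ℝ) ^ (t.1.1 : ℕ) * (((P.L : ℝ) ^ P.d)⁻¹) ^ (t.1.1 : ℕ)) else 0) * ((fun _ : BondIdx D => (1 : ℝ)) t)⁻¹ ≤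
      4 * (P.d : ℝ) * (((P.L : ℝ)⁻¹) ^ k) ^ 4 := by
  set η : ℝ := ((P.L : ℝ)⁻¹) ^ k with hη
  set lev : ℕ := levOf (fun j => {y : Site P 0 | D.InOm j y}) D.k b.src with hlev
  have hL1 : (1 : ℝ) ≤ P.L := by exact_mod_cast P.L_pos
  have hL0 : (0 : ℝ) < P.L := by linarith
  have hη0 : 0 ≤ η := by rw [hη]; positivity
  have hw3 : w 3 b = ((P.L : ℝ) ^ lev * η) ^ 3 := by rw [hw 3 b, hlev, hDk]
  have hw30 : 0 ≤ w 3 b := by rw [hw3]; positivity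
  have hsum := flatKernel_columnSum_le (by omega : 2 ≤ P.d) k D b
  -- `(L^{lev})³·(L·L^{−d})^{lev} = (L⁴·L^{−d})^{lev} ≤ 1`
  have hgeo : ((P.L : ℝ) ^ lev) ^ 3 * ((P.L : ℝ) * ((P.L : ℝ) ^ P.d)⁻¹) ^ lev ≤ 1 := by
    have h1 : ((P.L : ℝ) ^ lev) ^ 3 * ((P.L : ℝ) * ((P.L : ℝ) ^ P.d)⁻¹) ^ lev = ((P.L : ℝ) ^ 4 * ((P.L : ℝ) ^ P.d)⁻¹) ^ lev := by
      rw [mul_pow, mul_pow]; ring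
    rw [h1]
    refine pow_le_one₀ (by positivity) ?_
    rw [← div_eq_mul_inv, div_le_one (by positivity)]
    exact pow_le_pow_right₀ hL1 hd
  calc _ = w 3 b * ∑ t : BondIdx D,
        (if (iterBlockOf (t.1.1 : ℕ) b.src = t.1.2.src ∨ iterBlockOf (t.1.1 : ℕ) b.src = t.1.2.tgt) ∧
              (iterBlockOf (t.1.1 : ℕ) b.tgt = t.1.2.src ∨ iterBlockOf (t.1.1 : ℕ) b.tgt = t.1.2.tgt)
          then η * ((P.L : ℝ) ^ (t.1.1 : ℕ) * (((P.L : ℝ) ^ P.d)⁻¹) ^ (t.1.1 : ℕ)) else 0) := by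
        congr 1; refine Finset.sum_congr rfl fun t _ => ?_; simp only [inv_one, mul_one]
    _ ≤ w 3 b * (4 * (P.d : ℝ) * η * ((P.L : ℝ) * ((P.L : ℝ) ^ P.d)⁻¹) ^ lev) := mul_le_mul_of_nonneg_left hsum hw30
    _ = 4 * (P.d : ℝ) * η ^ 4 * (((P.L : ℝ) ^ lev) ^ 3 * ((P.L : ℝ) * ((P.L : ℝ) ^ P.d)⁻¹) ^ lev) := by rw [hw3]; ring
    _ ≤ 4 * (P.d : ℝ) * η ^ 4 * 1 := mul_le_mul_of_nonneg_left hgeo (by positivity)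
    _ = 4 * (P.d : ℝ) * η ^ 4 := mul_one _

end Column

/-! ## §2  `θ₀♭`: the `h73t` letter of the ♭ chart's remainder derivative, DISCHARGED (p624155 ∘ FILE A ∘ §1) -/

section Theta

variable {n : Type*} [Fintype n] [DecidableEq n] [Nonempty n]

/-- ★★★ **`θ₀♭` DISCHARGED, GENERIC CARRIER (`4 ≤ d`) AND MATRIX FIBRE.**  For a nested family `D` (`D.k = k`) admissible `Adm22 D R′ M` with `2L ≤ R′M + 1`, the (152)
weights, fibre letters (`τ` tracial contractive with dualiser `ρ`, `‖ρℓ‖ ≤ M_ρ‖ℓ‖`), the (27) pairing `BE = bondPair η d τ` (`η = (L⁻¹)^k`) and the block pairing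
`B = Σ_t τ`, ANY transposed derivative `Dt` of `Dfun♭ := chartLogFlat η D − D(chartLogFlat η D)(0)` (`BE (Dt A′ X) δ = B X (fderiv ℂ Dfun♭ A′ δ)`), and any radius `ε` inside
the four k-free windows of FILE A: the binder `h73t` of p612123 ∕ p621022 ∕ p623337 at unit block weight holds —
`sizes(A′) ≤ r < ε ⇒ (∀ i, 1·‖X i‖ ≤ s) → ∀ b, w 3 b‖Dt A′ X b‖ ≤ θ₀·r·s` with `θ₀ := (|η|ᵈ)⁻¹·M_ρ·Θ♭·(4d·η⁴)`, `Θ♭ = 16·A′·L∕(1 − 2∕L − 1∕12)`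
(this seat's `h73t_of_kernelEntries` fed with FILE A's `hentry_flat_P` and §1's `hcol_flat`).
[cite: Balaban1985Variational, (27) p.282, (72)-(73) p.289, Prop. 4 (98) p.293, (152) p.301, (157) p.302; Balaban1985Averaging, Prop. 5 (157) p.42] -/
theorem h73t_flat_P [DecidableEq (PBond P 0)] (hd : 4 ≤ P.d) (k : ℕ) (D : Domains P) (hDk : D.k = k) {R' Mb : ℕ} (hAdm : Adm22 D R' Mb)
    (hRM : 2 * P.L ≤ R' * Mb + 1) {w : ℕ → PBond P 0 → ℝ} (hw : IsLevWeight P k D w)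
    (τ : Matrix n n ℂ →L[ℂ] ℂ) (ρ : (Matrix n n ℂ →L[ℂ] ℂ) →L[ℂ] Matrix n n ℂ)
    (hρ : ∀ (ℓ' : Matrix n n ℂ →L[ℂ] ℂ) (X : Matrix n n ℂ), τ (ρ ℓ' * X) = ℓ' X) (hτ : ∀ a b : Matrix n n ℂ, τ (a * b) = τ (b * a))
    (hτ1 : ∀ X : Matrix n n ℂ, ‖τ X‖ ≤ ‖X‖) {Mρ : ℝ} (hMρ : 0 ≤ Mρ) (hρn : ∀ ℓ' : Matrix n n ℂ →L[ℂ] ℂ, ‖ρ ℓ'‖ ≤ Mρ * ‖ℓ'‖)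
    (BE : (PBond P 0 → Matrix n n ℂ) →L[ℂ] (PBond P 0 → Matrix n n ℂ) →L[ℂ] ℂ)
    (hBE : ∀ Y δ : PBond P 0 → Matrix n n ℂ, BE Y δ = bondPair (((P.L : ℝ)⁻¹) ^ k) P.d (τ : Matrix n n ℂ →ₗ[ℂ] ℂ) (fun μ x => Y ⟨x, μ⟩) (fun μ x => δ ⟨x, μ⟩))
    (B : (BondIdx D → Matrix n n ℂ) →L[ℂ] (BondIdx D → Matrix n n ℂ) →L[ℂ] ℂ) (hB : ∀ X X' : BondIdx D → Matrix n n ℂ, B X X' = ∑ t, τ (X t * X' t))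
    (Dt : (PBond P 0 → Matrix n n ℂ) → ((BondIdx D → Matrix n n ℂ) →L[ℂ] (PBond P 0 → Matrix n n ℂ)))
    (hDt : ∀ (A' : PBond P 0 → Matrix n n ℂ) X δ, BE (Dt A' X) δ = B X (fderiv ℂ (fun A : PBond P 0 → Matrix n n ℂ => chartLogFlat (((P.L : ℝ)⁻¹) ^ k) D A -
      (fderiv ℂ (chartLogFlat (((P.L : ℝ)⁻¹) ^ k) D : (PBond P 0 → Matrix n n ℂ) → BondIdx D → Matrix n n ℂ) 0) A) A' δ))
    {ε : ℝ}
    (hwin1 : 121600 * (((P.d + 2) * P.L : ℕ) : ℝ) ^ 2 * (P.L : ℝ) * ε ≤ 1)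
    (hwin2 : 51200 * (((P.d + 2) * P.L : ℕ) : ℝ) * (P.L : ℝ) * ε ≤ 1)
    (hwin3 : (2560 * (((P.d + 2) * P.L : ℕ) : ℝ) / (400 * (((P.d + 2) * P.L : ℕ) : ℝ))⁻¹) * (2 * (P.d : ℝ)) /
        ((P.L : ℝ) ^ 2 * ((P.L : ℝ) ^ P.d)⁻¹) * (16 * ((P.L : ℝ) * ε)) ≤ 1 / 12)
    (hwin4 : (P.L : ℝ) * ε ≤ 1 / 20) :
    ∀ (A' : PBond P 0 → Matrix n n ℂ) (r : ℝ), (∀ b, w 1 b * ‖A' b‖ ≤ r) →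
      (∀ (b : PBond P 0) (ν : Fin P.d), w 2 b * (P.L : ℝ) ^ k * ‖A' ⟨b.src.shift ν, b.dir⟩ - A' b‖ ≤ r) → r < ε →
      ∀ (X : BondIdx D → Matrix n n ℂ) (s : ℝ), (∀ i, (1 : ℝ) * ‖X i‖ ≤ s) → ∀ b, w 3 b * ‖Dt A' X b‖ ≤
        ((|((P.L : ℝ)⁻¹) ^ k| ^ P.d)⁻¹ * Mρ *
          (16 * ((2560 * (((P.d + 2) * P.L : ℕ) : ℝ) / (400 * (((P.d + 2) * P.L : ℕ) : ℝ))⁻¹) * (2 * (P.d : ℝ)) /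
            ((P.L : ℝ) ^ 2 * ((P.L : ℝ) ^ P.d)⁻¹)) * (P.L : ℝ) / (1 - 2 / (P.L : ℝ) - 1 / 12)) *
          (4 * (P.d : ℝ) * (((P.L : ℝ)⁻¹) ^ k) ^ 4)) * r * s := by
  haveI : Nonempty (BondIdx D) := nonempty_bondIdx D (by omega)
  have hL3 : 3 ≤ P.L := by obtain ⟨⟨k', hk'⟩, h1⟩ := P.hL; omega
  have hL3r : (3 : ℝ) ≤ P.L := by exact_mod_cast hL3
  have hL0 : (0 : ℝ) < P.L := by linarith
  have hη : (((P.L : ℝ)⁻¹) ^ k) ≠ 0 := by positivity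
  have hw1 : ∀ b, 0 ≤ w 1 b := fun b => by rw [hw 1 b]; positivity
  have hw3 : ∀ b, 0 ≤ w 3 b := fun b => by rw [hw 3 b]; positivity
  have hden : 0 < 1 - 2 / (P.L : ℝ) - 1 / 12 := by
    have : 2 / (P.L : ℝ) ≤ 2 / 3 := div_le_div_of_nonneg_left (by norm_num) (by norm_num) hL3r
    linarith
  have hΘ : 0 ≤ 16 * ((2560 * (((P.d + 2) * P.L : ℕ) : ℝ) / (400 * (((P.d + 2) * P.L : ℕ) : ℝ))⁻¹) * (2 * (P.d : ℝ)) /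
      ((P.L : ℝ) ^ 2 * ((P.L : ℝ) ^ P.d)⁻¹)) * (P.L : ℝ) / (1 - 2 / (P.L : ℝ) - 1 / 12) := div_nonneg (by positivity) hden.le
  have hk0 : ∀ (t : BondIdx D) (b : PBond P 0), 0 ≤
      (if (iterBlockOf (t.1.1 : ℕ) b.src = t.1.2.src ∨ iterBlockOf (t.1.1 : ℕ) b.src = t.1.2.tgt) ∧
            (iterBlockOf (t.1.1 : ℕ) b.tgt = t.1.2.src ∨ iterBlockOf (t.1.1 : ℕ) b.tgt = t.1.2.tgt)
        then ((P.L : ℝ)⁻¹) ^ k * ((P.L : ℝ) ^ (t.1.1 : ℕ) * (((P.L : ℝ) ^ P.d)⁻¹) ^ (t.1.1 : ℕ)) else 0) := by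
    intro t b; split_ifs <;> positivity
  intro A' r h0 h1 hr X s hX b
  exact h73t_of_kernelEntries k D w hw1 hw3 τ ρ hρ hτ hτ1 hMρ hρn hη BE hBE B hB _ Dt hDt _ hk0 hΘ
    (hentry_flat_P (n := n) k D hDk hAdm hRM hw hwin1 hwin2 hwin3 hwin4) (fun _ => (1 : ℝ)) (fun _ => zero_lt_one)
    (hcol_flat hd k D hDk hw) A' r h0 h1 hr X s hX b

/-- ★★★ **`θ₀♭` AT THE RECORD, k-UNIFORM**: §2 on the four-torus `F.P K` of a `T4Family` ([Balaban1987RG1] (0.1); `d = 4`, `η = L^{−(K−n)} > 0`), fibre `M_N(ℂ)`: the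
`h73t` binder of p623337 ∕ p625916 holds with `θ₀♭ := (16·Θ♭(L))·M_ρ`, `Θ♭(L) = 16·A′·L∕(1 − 2∕L − 1∕12)`, `A′ = (2560·6L∕(400·6L)⁻¹)·8∕(L²(L⁴)⁻¹)` — a function of `L`
(and of the fibre's dualiser constant `M_ρ`) ONLY: the LOCATED-BASEPOINT obstruction of the single-bar chart (evidence #51: `θ₀ ≍ L^{3(K−n)}`) is absent on the ♭ road.
[cite: Balaban1985Variational, (27) p.282, (72)-(73) p.289, (152) p.301, (157) p.302; Balaban1985Averaging, Prop. 5 (157) p.42; Balaban1987RG1, (0.1) p.251] -/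
theorem h73t_flat_T4 (N : ℕ) [NeZero N] (F : T4Family) (n K : ℕ) [DecidableEq (PBond (F.P K) 0)] (D : Domains (F.P K)) (hDk : D.k = K - n)
    {R' Mb : ℕ} (hAdm : Adm22 D R' Mb) (hRM : 2 * (F.P K).L ≤ R' * Mb + 1)
    {w : ℕ → PBond (F.P K) 0 → ℝ} (hw : IsLevWeight (F.P K) (K - n) D w)
    (τ : Matrix (Fin N) (Fin N) ℂ →L[ℂ] ℂ) (ρ : (Matrix (Fin N) (Fin N) ℂ →L[ℂ] ℂ) →L[ℂ] Matrix (Fin N) (Fin N) ℂ)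
    (hρ : ∀ (ℓ' : Matrix (Fin N) (Fin N) ℂ →L[ℂ] ℂ) (X : Matrix (Fin N) (Fin N) ℂ), τ (ρ ℓ' * X) = ℓ' X)
    (hτ : ∀ a b : Matrix (Fin N) (Fin N) ℂ, τ (a * b) = τ (b * a))
    (hτ1 : ∀ X : Matrix (Fin N) (Fin N) ℂ, ‖τ X‖ ≤ ‖X‖) {Mρ : ℝ} (hMρ : 0 ≤ Mρ) (hρn : ∀ ℓ' : Matrix (Fin N) (Fin N) ℂ →L[ℂ] ℂ, ‖ρ ℓ'‖ ≤ Mρ * ‖ℓ'‖)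
    (BE : (PBond (F.P K) 0 → Matrix (Fin N) (Fin N) ℂ) →L[ℂ] (PBond (F.P K) 0 → Matrix (Fin N) (Fin N) ℂ) →L[ℂ] ℂ)
    (hBE : ∀ Y δ : PBond (F.P K) 0 → Matrix (Fin N) (Fin N) ℂ, BE Y δ =
      bondPair ((((F.P K).L : ℝ))⁻¹ ^ (K - n)) (F.P K).d (τ : Matrix (Fin N) (Fin N) ℂ →ₗ[ℂ] ℂ) (fun μ x => Y ⟨x, μ⟩) (fun μ x => δ ⟨x, μ⟩))
    (B : (BondIdx D → Matrix (Fin N) (Fin N) ℂ) →L[ℂ] (BondIdx D → Matrix (Fin N) (Fin N) ℂ) →L[ℂ] ℂ)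
    (hB : ∀ X X' : BondIdx D → Matrix (Fin N) (Fin N) ℂ, B X X' = ∑ t, τ (X t * X' t))
    (Dt : (PBond (F.P K) 0 → Matrix (Fin N) (Fin N) ℂ) → ((BondIdx D → Matrix (Fin N) (Fin N) ℂ) →L[ℂ] (PBond (F.P K) 0 → Matrix (Fin N) (Fin N) ℂ)))
    (hDt : ∀ (A' : PBond (F.P K) 0 → Matrix (Fin N) (Fin N) ℂ) X δ, BE (Dt A' X) δ = B X (fderiv ℂ (fun A : PBond (F.P K) 0 → Matrix (Fin N) (Fin N) ℂ =>
      chartLogFlat (((((F.P K).L : ℝ))⁻¹) ^ (K - n)) D A -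
        (fderiv ℂ (chartLogFlat (((((F.P K).L : ℝ))⁻¹) ^ (K - n)) D : (PBond (F.P K) 0 → Matrix (Fin N) (Fin N) ℂ) → BondIdx D → Matrix (Fin N) (Fin N) ℂ) 0) A) A' δ))
    {ε : ℝ}
    (hwin1 : 121600 * ((((F.P K).d + 2) * (F.P K).L : ℕ) : ℝ) ^ 2 * ((F.P K).L : ℝ) * ε ≤ 1)
    (hwin2 : 51200 * ((((F.P K).d + 2) * (F.P K).L : ℕ) : ℝ) * ((F.P K).L : ℝ) * ε ≤ 1)
    (hwin3 : (2560 * ((((F.P K).d + 2) * (F.P K).L : ℕ) : ℝ) / (400 * ((((F.P K).d + 2) * (F.P K).L : ℕ) : ℝ))⁻¹) * (2 * ((F.P K).d : ℝ)) /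
        (((F.P K).L : ℝ) ^ 2 * (((F.P K).L : ℝ) ^ (F.P K).d)⁻¹) * (16 * (((F.P K).L : ℝ) * ε)) ≤ 1 / 12)
    (hwin4 : ((F.P K).L : ℝ) * ε ≤ 1 / 20) :
    ∀ (A' : PBond (F.P K) 0 → Matrix (Fin N) (Fin N) ℂ) (r : ℝ), (∀ b, w 1 b * ‖A' b‖ ≤ r) →
      (∀ (b : PBond (F.P K) 0) (ν : Fin (F.P K).d), w 2 b * ((F.P K).L : ℝ) ^ (K - n) * ‖A' ⟨b.src.shift ν, b.dir⟩ - A' b‖ ≤ r) → r < ε →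
      ∀ (X : BondIdx D → Matrix (Fin N) (Fin N) ℂ) (s : ℝ), (∀ i, (1 : ℝ) * ‖X i‖ ≤ s) → ∀ b, w 3 b * ‖Dt A' X b‖ ≤
        ((16 * (16 * ((2560 * ((((F.P K).d + 2) * (F.P K).L : ℕ) : ℝ) / (400 * ((((F.P K).d + 2) * (F.P K).L : ℕ) : ℝ))⁻¹) * (2 * ((F.P K).d : ℝ)) /
            (((F.P K).L : ℝ) ^ 2 * (((F.P K).L : ℝ) ^ (F.P K).d)⁻¹)) * ((F.P K).L : ℝ) / (1 - 2 / ((F.P K).L : ℝ) - 1 / 12))) * Mρ) * r * s := by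
  intro A' r h0 h1 hr X s hX b
  have hd : 4 ≤ (F.P K).d := le_of_eq (T4Family.P_d F K).symm
  have h := h73t_flat_P (n := Fin N) hd (K - n) D hDk hAdm hRM hw τ ρ hρ hτ hτ1 hMρ hρn BE hBE B hB Dt hDt hwin1 hwin2 hwin3 hwin4 A' r h0 h1 hr X s hX b
  refine h.trans (le_of_eq ?_)
  -- `(|η|⁴)⁻¹·(4·4·η⁴) = 16` at `d = 4`
  have hL0 : (0 : ℝ) < ((F.P K).L : ℝ) := by exact_mod_cast (F.P K).L_pos
  have hη0 : 0 < (((F.P K).L : ℝ)⁻¹) ^ (K - n) := by positivity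
  have hd4 : (F.P K).d = 4 := T4Family.P_d F K
  rw [abs_of_pos hη0, hd4]
  have hη4 : ((((F.P K).L : ℝ)⁻¹) ^ (K - n)) ^ 4 ≠ 0 := by positivity
  field_simp
  push_cast
  ring

end Theta

end Summit.QuantumFields.YangMills.Theorems.K0Stub1FlatChartTheta0AtRecord

end
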